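import Mathlib
import HarnessLib
import Summits.Ventures.LatticeQCDFlow.Exactness.InvolutiveMetropolis
import Summits.Ventures.LatticeQCDFlow.Exactness.MomentumRefresh

/-!
# LatticeQCDFlow / Scaling — TUNNELLING LAWS IV: molecular-dynamics trajectories and the HMC update (abstract engine)

HONEST FRAMING: exact (Metropolis-corrected) sampling algorithms for lattice gauge theory;
figures of merit are autocorrelation/cost numbers at stated couplings and volumes; no
continuum-physics claim.

THEORY-2.md §3.3 / §5 (v4.3, theory seat GEN-24).  The tunnelling laws I–III of the tree
(`Scaling/TunnellingLaws.lean`, `Scaling/FluxTunnelling.lean`, …) price ONE exact update `U → U'`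
through a separating set that `U` or `U'` must visit.  For HMC the update is a whole molecular-dynamics
(MD) trajectory of `n` integrator steps followed by an accept/reject decision, and the per-update
separating set (sup-metric collar `4ρ`, `ρ` = total displacement of the trajectory) is vacuous at
production step sizes (`Scaling/BarriersTunnelling.lean`, scope_caveats).  This file prices the
INTERIOR NODES of the trajectory instead.  Everything is NEW WORK of the cell over Mathlib's measure /
Markov-kernel library; the printed heuristic it makes a theorem is "the fields along the trajectories
are, to a good approximation, distributed according to their weight in the functional integral"
[cite: Luscher2010WilsonFlow, p.7]; nearest printed theorem: the conductance formula / surface-integral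
bound for IDEALISED (exact-flow) HMC of [cite: MangoubiPillaiSmith2018, Thm 1, Cor 2] — here the
integrator is an arbitrary finite composition of volume-preserving maps of any accuracy, and the
accuracy enters only through the energy-violation tails.

## Content (reference measure `vol` on a measurable space `X`, energy `H : X → ℝ`, `e^{-H}·vol`)

* §1 `boltz vol H = e^{-H}·vol`; **transfer lemma** `boltz_preimage_le`: for a measurable
  `vol`-preserving `Ψ` and every measurable `A`, every `h : ℝ`,
  `e^{-H}vol (Ψ⁻¹ A) ≤ e^{h} · e^{-H}vol (A) + e^{-H}vol {x | H (Ψ x) - H x > h}`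
  — the image of the Boltzmann law under a volume-preserving map is dominated by `e^{h}` times the
  Boltzmann law plus the energy-violation tail (the rigorous form of "intermediate fields are
  distributed by their weight"; `h = 0` and `H ∘ Ψ = H` is exact invariance).
* §2 `nodes step k` = the composition `step (k-1) ∘ ⋯ ∘ step 0`; **MD NODE LAW**
  `boltz_charge_nodes_ne_le_sum`: if each `step k` preserves `vol` and a change of the charge `Q`
  across step `k` forces the pre-step point into a measurable set `C k`, then for every `h`, `n`:
  `e^{-H}vol {x | Q (nodes step n x) ≠ Q x} ≤ Σ_{k<n} (e^{h} · e^{-H}vol (C k) + e^{-H}vol {ΔH_k > h})`,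
  `ΔH_k (x) = H (nodes step k x) - H x` the energy violation at node `k`.
* §3 **HMC UPDATE LAW** `compProd_refreshUpdate_involMH_chargeNe_le`: for the HMC-type configuration
  kernel `K = refreshUpdate (involMH Φ _ H) μP` of `Exactness/MomentumRefresh.lean` (refresh the momenta
  from a probability law `μP`, propose the deterministic phase-space move `Φ`, Metropolis-accept, forget
  the momenta) and EVERY s-finite `μ`:
  `(μ ⊗ K){(u,u') | Q u ≠ Q u'} ≤ (μ ⊗ μP){z | Q z.1 ≠ Q (Φ z).1}` — a rejected proposal never changes
  the configuration, so the update changes the charge at most as often as the bare map `Φ` does on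
  `μ ⊗ μP`-distributed phase points (no involution / volume hypothesis on `Φ`, no invariance of `μ`).
  `hmc_chargeNe_le_sum`: the two combined for `H (u,π) = S u + T π`, `μ = e^{-S}vol`,
  `μP = Z_T⁻¹ e^{-T}volP` (the kernel of `hmc_config_exact`, verbatim) and `Φ = flip ∘ nodes step n` with
  a configuration-preserving `flip`:
  `(e^{-S}vol ⊗ K){Q ≠ Q'} ≤ Z_T⁻¹ · Σ_{k<n} (e^{h} · B (C k) + B {ΔH_k > h})`, `B = e^{-(S+T)}(vol ⊗ volP)`.
The lattice instance (compact `U(1)`, MD drifts `U_e ↦ exp(i δ ϖ_e) U_e`, the MOMENTUM COLLAR as `C k`)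
is `Scaling/MDFluxTunnelling.lean`.

Not here: any estimate of the collar masses or of the energy-violation tails (hypotheses / measured
inputs), ergodicity, the `SU(N)` ε-sector instance.
-/

noncomputable section

namespace Summit.Ventures.LatticeQCDFlow.Theory2.Tunnelling.MD

open MeasureTheory ProbabilityTheory Set
open scoped ENNReal
open Summit.Ventures.LatticeQCDFlow.Exactness

variable {X : Type*} [MeasurableSpace X]

/-! ## §1. The Boltzmann law and the transfer lemma -/

/-- The (un-normalised) Boltzmann law `e^{-H} · vol`. [folklore] -/
abbrev boltz (vol : Measure X) (H : X → ℝ) : Measure X :=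
  vol.withDensity fun x => ENNReal.ofReal (Real.exp (-H x))

/-- The Boltzmann density `e^{-H}` is measurable for measurable `H`. [folklore] -/
theorem measurable_expNeg {H : X → ℝ} (hH : Measurable H) :
    Measurable fun x => ENNReal.ofReal (Real.exp (-H x)) :=
  ENNReal.measurable_ofReal.comp (Real.measurable_exp.comp hH.neg)

/-- **Transfer lemma.**  For a measurable `vol`-preserving map `Ψ`, a measurable set `A` and any
`h : ℝ`: `e^{-H}vol (Ψ⁻¹ A) ≤ e^{h} · e^{-H}vol (A) + e^{-H}vol {x | h < H (Ψ x) - H x}`.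
Proof: on `{H ∘ Ψ - H ≤ h}` the weight `e^{-H x}` is at most `e^{h} e^{-H (Ψ x)}`, and
`∫_{Ψ⁻¹ A} e^{-H (Ψ x)} dvol = ∫_A e^{-H} dvol` by volume preservation. [folklore] -/
theorem boltz_preimage_le (vol : Measure X) {H : X → ℝ} (hH : Measurable H) {Ψ : X → X}
    (hΨ : MeasurePreserving Ψ vol vol) {A : Set X} (hA : MeasurableSet A) (h : ℝ) :
    boltz vol H (Ψ ⁻¹' A) ≤
      ENNReal.ofReal (Real.exp h) * boltz vol H A + boltz vol H {x | h < H (Ψ x) - H x} := by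
  set G : Set X := {x | H (Ψ x) - H x ≤ h} with hG_def
  have hGm : MeasurableSet G :=
    measurableSet_le ((hH.comp hΨ.measurable).sub hH) measurable_const
  have hΨA : MeasurableSet (Ψ ⁻¹' A) := hΨ.measurable hA
  have hF : Measurable fun y => ENNReal.ofReal (Real.exp (-H y)) := measurable_expNeg hH
  have hsplit : Ψ ⁻¹' A ⊆ (Ψ ⁻¹' A ∩ G) ∪ {x | h < H (Ψ x) - H x} := by
    intro x hx
    by_cases hxG : x ∈ G
    · exact Or.inl ⟨hx, hxG⟩
    · right
      have hx' : ¬ (H (Ψ x) - H x ≤ h) := hxG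
      simp only [mem_setOf_eq]
      exact not_le.mp hx'
  have hmain : boltz vol H (Ψ ⁻¹' A ∩ G) ≤ ENNReal.ofReal (Real.exp h) * boltz vol H A := by
    calc boltz vol H (Ψ ⁻¹' A ∩ G)
        = ∫⁻ x in Ψ ⁻¹' A ∩ G, ENNReal.ofReal (Real.exp (-H x)) ∂vol :=
          withDensity_apply _ (hΨA.inter hGm)
      _ ≤ ∫⁻ x in Ψ ⁻¹' A ∩ G,
            ENNReal.ofReal (Real.exp h) * ENNReal.ofReal (Real.exp (-H (Ψ x))) ∂vol := by
          refine setLIntegral_mono' (hΨA.inter hGm) fun x hx => ?_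
          have hx2 : H (Ψ x) - H x ≤ h := hx.2
          rw [← ENNReal.ofReal_mul (Real.exp_nonneg h), ← Real.exp_add]
          exact ENNReal.ofReal_le_ofReal (Real.exp_le_exp.mpr (by linarith))
      _ ≤ ∫⁻ x in Ψ ⁻¹' A,
            ENNReal.ofReal (Real.exp h) * ENNReal.ofReal (Real.exp (-H (Ψ x))) ∂vol :=
          lintegral_mono_set inter_subset_left
      _ = ENNReal.ofReal (Real.exp h) *
            ∫⁻ x in Ψ ⁻¹' A, ENNReal.ofReal (Real.exp (-H (Ψ x))) ∂vol :=
          lintegral_const_mul' _ _ ENNReal.ofReal_ne_top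
      _ = ENNReal.ofReal (Real.exp h) * ∫⁻ y in A, ENNReal.ofReal (Real.exp (-H y)) ∂(vol.map Ψ) := by
          rw [setLIntegral_map hA hF hΨ.measurable]
      _ = ENNReal.ofReal (Real.exp h) * boltz vol H A := by
          rw [hΨ.map_eq, withDensity_apply _ hA]
  calc boltz vol H (Ψ ⁻¹' A)
      ≤ boltz vol H (Ψ ⁻¹' A ∩ G) + boltz vol H {x | h < H (Ψ x) - H x} :=
        (measure_mono hsplit).trans (measure_union_le _ _)
    _ ≤ ENNReal.ofReal (Real.exp h) * boltz vol H A + boltz vol H {x | h < H (Ψ x) - H x} :=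
        add_le_add hmain le_rfl

/-- The exact case: a `vol`-preserving map that conserves `H` does not increase the `e^{-H}vol`-mass
of measurable sets under preimage. [folklore] -/
theorem boltz_preimage_le_of_conserved (vol : Measure X) {H : X → ℝ} (hH : Measurable H) {Ψ : X → X}
    (hΨ : MeasurePreserving Ψ vol vol) (hcons : ∀ x, H (Ψ x) = H x) {A : Set X}
    (hA : MeasurableSet A) : boltz vol H (Ψ ⁻¹' A) ≤ boltz vol H A := by
  have h := boltz_preimage_le vol hH hΨ hA 0
  have he : {x | (0 : ℝ) < H (Ψ x) - H x} = ∅ := by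
    ext x; simp [hcons x]
  rwa [he, measure_empty, add_zero, Real.exp_zero, ENNReal.ofReal_one, one_mul] at h

/-! ## §2. Nodes of a trajectory and the MD node law -/

/-- The nodes of a trajectory built from the steps `step 0, step 1, …`:
`nodes step 0 = id`, `nodes step (k+1) = step k ∘ nodes step k`. [folklore] -/
def nodes {Z : Type*} (step : ℕ → Z → Z) : ℕ → Z → Z
  | 0 => id
  | k + 1 => step k ∘ nodes step k

/-- Node `0` is the initial phase point. [folklore] -/
@[simp] theorem nodes_zero {Z : Type*} (step : ℕ → Z → Z) (z : Z) : nodes step 0 z = z := rfl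

/-- Node `k+1` is step `k` applied to node `k`. [folklore] -/
@[simp] theorem nodes_succ {Z : Type*} (step : ℕ → Z → Z) (k : ℕ) (z : Z) :
    nodes step (k + 1) z = step k (nodes step k z) := rfl

/-- Nodes of measurable steps are measurable maps. [folklore] -/
theorem measurable_nodes {step : ℕ → X → X} (hstep : ∀ k, Measurable (step k)) (k : ℕ) :
    Measurable (nodes step k) := by
  induction k with
  | zero => exact measurable_id
  | succ k ih => exact (hstep k).comp ih

/-- Nodes of volume-preserving steps preserve volume. [folklore] -/
theorem measurePreserving_nodes {vol : Measure X} {step : ℕ → X → X}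
    (hstep : ∀ k, MeasurePreserving (step k) vol vol) (k : ℕ) :
    MeasurePreserving (nodes step k) vol vol := by
  induction k with
  | zero => exact MeasurePreserving.id vol
  | succ k ih => exact (hstep k).comp ih

/-- Deterministic core: if the charge differs between node `n` and node `0`, it changes across some
step `k < n`. [folklore] -/
theorem exists_step_chargeNe_of_nodes_ne {Z ι : Type*} (step : ℕ → Z → Z) (Q : Z → ι) (z : Z)
    {n : ℕ} (hQ : Q (nodes step n z) ≠ Q z) :
    ∃ k < n, Q (step k (nodes step k z)) ≠ Q (nodes step k z) := by
  by_contra hcon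
  apply hQ
  suffices hk : ∀ k ≤ n, Q (nodes step k z) = Q z from hk n le_rfl
  intro k
  induction k with
  | zero => intro; rfl
  | succ k ih =>
      intro hk
      have hk' : k < n := Nat.lt_of_succ_le hk
      rw [nodes_succ]
      by_cases hc : Q (step k (nodes step k z)) = Q (nodes step k z)
      · rw [hc, ih hk'.le]
      · exact absurd ⟨k, hk', hc⟩ hcon

/-- **MD NODE LAW.**  Steps `step k` measurable and `vol`-preserving; `C k` a measurable set the
pre-step point must lie in whenever step `k` changes the charge.  Then for every `h : ℝ` and `n`:
`e^{-H}vol {Q (node n) ≠ Q (node 0)} ≤ Σ_{k<n} (e^{h} · e^{-H}vol (C k) + e^{-H}vol {ΔH_k > h})`, with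
`ΔH_k (x) = H (nodes step k x) - H x` the energy violation accumulated up to node `k`. [folklore] -/
theorem boltz_charge_nodes_ne_le_sum (vol : Measure X) {H : X → ℝ} (hH : Measurable H) {ι : Type*}
    (Q : X → ι) {step : ℕ → X → X} (hstep : ∀ k, MeasurePreserving (step k) vol vol)
    (C : ℕ → Set X) (hC : ∀ k, MeasurableSet (C k))
    (hsep : ∀ k x, Q (step k x) ≠ Q x → x ∈ C k) (h : ℝ) (n : ℕ) :
    boltz vol H {x | Q (nodes step n x) ≠ Q x} ≤
      ∑ k ∈ Finset.range n, (ENNReal.ofReal (Real.exp h) * boltz vol H (C k) +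
        boltz vol H {x | h < H (nodes step k x) - H x}) := by
  have hsub : {x | Q (nodes step n x) ≠ Q x} ⊆ ⋃ k ∈ Finset.range n, nodes step k ⁻¹' C k := by
    intro x hx
    obtain ⟨k, hk, hne⟩ := exists_step_chargeNe_of_nodes_ne step Q x hx
    simp only [mem_iUnion, Finset.mem_range, mem_preimage, exists_prop]
    exact ⟨k, hk, hsep k _ hne⟩
  calc boltz vol H {x | Q (nodes step n x) ≠ Q x}
      ≤ boltz vol H (⋃ k ∈ Finset.range n, nodes step k ⁻¹' C k) := measure_mono hsub
    _ ≤ ∑ k ∈ Finset.range n, boltz vol H (nodes step k ⁻¹' C k) :=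
        measure_biUnion_finset_le _ _
    _ ≤ _ := Finset.sum_le_sum fun k _ =>
        boltz_preimage_le vol hH (measurePreserving_nodes hstep k) (hC k) h

/-! ## §3. The HMC update: rejections never tunnel -/

section HMC

variable {Ω P : Type*} [MeasurableSpace Ω] [MeasurableSpace P]

/-- **HMC UPDATE LAW (kernel form).**  For the refresh–propose-`Φ`–Metropolis–forget kernel
`K = refreshUpdate (involMH Φ _ H) μP` (momentum law `μP` a probability measure) and every s-finite
`μ`: `(μ ⊗ K){(u,u') | Q u ≠ Q u'} ≤ (μ ⊗ μP){z | Q z.1 ≠ Q (Φ z).1}` — the accepted branch moves to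
`Φ z`, the rejected branch keeps the configuration.  No hypothesis on `Φ` beyond measurability, none
on `μ`. [folklore] -/
theorem compProd_refreshUpdate_involMH_chargeNe_le {Φ : Ω × P → Ω × P} (hΦ : Measurable Φ)
    {H : Ω × P → ℝ} (hH : Measurable H) (μ : Measure Ω) [SFinite μ] (μP : Measure P)
    [IsProbabilityMeasure μP] {Q : Ω → ℝ} (hQ : Measurable Q) :
    (μ ⊗ₘ refreshUpdate (involMH Φ hΦ H) μP) {q : Ω × Ω | Q q.1 ≠ Q q.2} ≤
      (μ.prod μP) {z : Ω × P | Q z.1 ≠ Q (Φ z).1} := by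
  haveI : Fact (Measurable H) := ⟨hH⟩
  set D : Set (Ω × P) := {z | Q z.1 ≠ Q (Φ z).1} with hD_def
  have hSm : MeasurableSet {q : Ω × Ω | Q q.1 ≠ Q q.2} :=
    (measurableSet_eq_fun (hQ.comp measurable_fst) (hQ.comp measurable_snd)).compl
  have hDm : MeasurableSet D :=
    (measurableSet_eq_fun (hQ.comp measurable_fst) (hQ.comp (measurable_fst.comp hΦ))).compl
  have hTu : ∀ u : Ω, MeasurableSet {u' : Ω | Q u ≠ Q u'} := fun u =>
    (measurableSet_eq_fun measurable_const hQ).compl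
  rw [Measure.compProd_apply hSm]
  calc ∫⁻ u, refreshUpdate (involMH Φ hΦ H) μP u (Prod.mk u ⁻¹' {q : Ω × Ω | Q q.1 ≠ Q q.2}) ∂μ
      ≤ ∫⁻ u, ∫⁻ π, D.indicator 1 (u, π) ∂μP ∂μ := by
        refine lintegral_mono fun u => ?_
        have hpre : Prod.mk u ⁻¹' {q : Ω × Ω | Q q.1 ≠ Q q.2} = {u' | Q u ≠ Q u'} := rfl
        rw [hpre, refreshUpdate_apply' _ _ _ (hTu u)]
        refine lintegral_mono fun π => ?_
        rw [involMH_apply hH _ (measurable_fst (hTu u))]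
        have h2 : (Prod.fst ⁻¹' {u' : Ω | Q u ≠ Q u'}).indicator (1 : Ω × P → ℝ≥0∞) (u, π) = 0 :=
          indicator_of_notMem (by simp) _
        have h1 : (Prod.fst ⁻¹' {u' : Ω | Q u ≠ Q u'}).indicator (1 : Ω × P → ℝ≥0∞) (Φ (u, π)) =
            D.indicator 1 (u, π) := by
          by_cases hq : Q u ≠ Q (Φ (u, π)).1
          · rw [indicator_of_mem (show Φ (u, π) ∈ Prod.fst ⁻¹' {u' : Ω | Q u ≠ Q u'} from hq),
              indicator_of_mem (show (u, π) ∈ D from hq)]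
            simp only [Pi.one_apply]
          · rw [indicator_of_notMem (show Φ (u, π) ∉ Prod.fst ⁻¹' {u' : Ω | Q u ≠ Q u'} from hq),
              indicator_of_notMem (show (u, π) ∉ D from hq)]
        rw [h2, mul_zero, add_zero, h1]
        exact mul_le_of_le_one_left' (involAcceptE_le_one _ _ _)
    _ = ∫⁻ z, D.indicator 1 z ∂(μ.prod μP) :=
        (lintegral_prod _ (measurable_one.indicator hDm).aemeasurable).symm
    _ = (μ.prod μP) D := lintegral_indicator_one hDm

/-- **HMC TUNNELLING LAW (abstract).**  Target `e^{-S}vol`, kinetic term `T` with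
`0 < Z_T < ∞`, momentum law `Z_T⁻¹ e^{-T}volP` — the kernel of `hmc_config_exact`, verbatim; the
proposal `Φ = flip ∘ (nodes step n)` for `vol ⊗ volP`-preserving measurable steps and a measurable
`flip` that does not touch the configuration; `C k` measurable separating sets for the steps.  Then
for every `h : ℝ`:
`(e^{-S}vol ⊗ K){Q ≠ Q'} ≤ Z_T⁻¹ · Σ_{k<n} (e^{h} · B (C k) + B {z | h < H (nodes step k z) - H z})`,
`B = e^{-H}(vol ⊗ volP)`, `H (u,π) = S u + T π`.  Divide by `Z_S` for the stationary per-update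
probability.  (`Φ` need not be an involution here: exactness needs it, the tunnelling bound does not.)
[folklore] -/
theorem hmc_chargeNe_le_sum (vol : Measure Ω) (volP : Measure P) [SFinite vol] [SFinite volP]
    {S : Ω → ℝ} (hS : Measurable S) {T : P → ℝ} (hT : Measurable T)
    {step : ℕ → Ω × P → Ω × P}
    (hstep : ∀ k, MeasurePreserving (step k) (vol.prod volP) (vol.prod volP))
    {flip : Ω × P → Ω × P} (hflip : ∀ z, (flip z).1 = z.1) (n : ℕ)
    {Φ : Ω × P → Ω × P} (hΦ : Measurable Φ) (hΦeq : ∀ z, Φ z = flip (nodes step n z))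
    {Q : Ω → ℝ} (hQ : Measurable Q) (C : ℕ → Set (Ω × P)) (hC : ∀ k, MeasurableSet (C k))
    (hsep : ∀ k z, Q (step k z).1 ≠ Q z.1 → z ∈ C k)
    (hZ0 : volP.withDensity (fun π => ENNReal.ofReal (Real.exp (-T π))) Set.univ ≠ 0)
    (hZtop : volP.withDensity (fun π => ENNReal.ofReal (Real.exp (-T π))) Set.univ ≠ ∞) (h : ℝ) :
    (boltz vol S ⊗ₘ
        refreshUpdate (involMH Φ hΦ fun z : Ω × P => S z.1 + T z.2)
          ((volP.withDensity (fun π => ENNReal.ofReal (Real.exp (-T π))) Set.univ)⁻¹ •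
            volP.withDensity fun π => ENNReal.ofReal (Real.exp (-T π))))
      {q : Ω × Ω | Q q.1 ≠ Q q.2} ≤
      (volP.withDensity (fun π => ENNReal.ofReal (Real.exp (-T π))) Set.univ)⁻¹ *
        ∑ k ∈ Finset.range n,
          (ENNReal.ofReal (Real.exp h) * boltz (vol.prod volP) (fun z => S z.1 + T z.2) (C k) +
            boltz (vol.prod volP) (fun z => S z.1 + T z.2)
              {z | h < (S (nodes step k z).1 + T (nodes step k z).2) - (S z.1 + T z.2)}) := by
  set νT := volP.withDensity fun π => ENNReal.ofReal (Real.exp (-T π)) with hνT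
  set Z := νT Set.univ with hZ
  haveI : IsProbabilityMeasure (Z⁻¹ • νT) :=
    ⟨by rw [Measure.smul_apply, smul_eq_mul, ENNReal.inv_mul_cancel hZ0 hZtop]⟩
  have hH : Measurable fun z : Ω × P => S z.1 + T z.2 :=
    (hS.comp measurable_fst).add (hT.comp measurable_snd)
  -- rejections never tunnel
  have h1 := compProd_refreshUpdate_involMH_chargeNe_le hΦ hH (boltz vol S) (Z⁻¹ • νT) hQ
  -- the phase-space law is `Z⁻¹ • e^{-H}(vol ⊗ volP)`
  have hprod : (boltz vol S).prod (Z⁻¹ • νT) =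
      Z⁻¹ • boltz (vol.prod volP) (fun z : Ω × P => S z.1 + T z.2) := by
    rw [Measure.prod_smul_right, hνT]
    unfold boltz
    rw [withDensity_exp_neg_add_prod vol volP hS hT]
  -- a change of the charge of the configuration under `Φ` is a change along the trajectory
  have hDsub : {z : Ω × P | Q z.1 ≠ Q (Φ z).1} ⊆
      {z | (fun w : Ω × P => Q w.1) (nodes step n z) ≠ (fun w : Ω × P => Q w.1) z} := by
    intro z hz
    simp only [mem_setOf_eq] at hz ⊢
    rw [hΦeq z, hflip] at hz
    exact fun heq => hz heq.symm
  have h2 := boltz_charge_nodes_ne_le_sum (vol.prod volP) hH (fun w : Ω × P => Q w.1) hstep C hC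
    hsep h n
  calc _ ≤ ((boltz vol S).prod (Z⁻¹ • νT)) {z : Ω × P | Q z.1 ≠ Q (Φ z).1} := h1
    _ = Z⁻¹ * boltz (vol.prod volP) (fun z : Ω × P => S z.1 + T z.2)
          {z : Ω × P | Q z.1 ≠ Q (Φ z).1} := by rw [hprod, Measure.smul_apply, smul_eq_mul]
    _ ≤ Z⁻¹ * boltz (vol.prod volP) (fun z : Ω × P => S z.1 + T z.2)
          {z | (fun w : Ω × P => Q w.1) (nodes step n z) ≠ (fun w : Ω × P => Q w.1) z} := by
        gcongr
    _ ≤ _ := by gcongr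

end HMC

end Summit.Ventures.LatticeQCDFlow.Theory2.Tunnelling.MD

end
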